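import Summits.KontsevichZagierPeriods.KontsevichZagierPeriods.Theorems.TerasomaMultiplicationGammaHodgeFromRelators
import Summits.KontsevichZagierPeriods.KontsevichZagierPeriods.Theorems.TerasomaMultiplicationGammaHodgeSectorPowerIdentity
import Summits.KontsevichZagierPeriods.KontsevichZagierPeriods.Theorems.GammaHodgeSector.Negative.Canonical
import Summits.KontsevichZagierPeriods.KontsevichZagierPeriods.Theses.FermatIsogeny

/-!
# `GammaHodgeSector` (stmt-KontsevichZagierPeriods-3742) — the parametric relator compiler

Crux `Summit.KontsevichZagierPeriods.KontsevichZagierPeriods.Theses.TerasomaMultiplication.GammaHodgeSector`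
(Deligne / Koblitz–Ogus Hodge-type Beta identities inside the Kontsevich–Zagier rules).

The landed glue `GammaHodgeFromRelators` (stmt-14947) compiles the crux from
`MultiplicationAccessible` (12305), `BetaCancellation` (13633), ONE extra solved pair (`g₁₂`,
`DasGapTwelve`, 13215) and the residual `GapSectorBeyondTwelve` (14858). This file states the
same compiler PARAMETRICALLY in the set `S` of extra Beta-word pairs known to hold in
`P = FormalRep ⧸ relations` up to a positive algebraic constant:

* `gammaHodgeSector_of_solvedPairs` — `12305 → 13633 → (every pair of S holds in P) →
  (the crux restricted to data whose symbol lies OUTSIDE RelSpan ⊔ ⟨S⟩) → GammaHodgeSector`;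
* `isConstMultiple_of_instance` — every instance of the crux, however it is proved (a new
  correspondence, a level-by-level engine, …), IS a solved pair: from `r ∼ r'` for one pinned pair
  the Beta words satisfy `Π β(W) = κ(c)·β(½,½)^k·Π β(W')` in `P`;
* `isConstMultiple_of_gammaHodgeSector` / `gap_of_gammaHodgeSector` — conversely the crux solves
  every admissible Hodge-type pair and trivially contains every residual;
* `gammaHodgeSector_of_gapBeyondRelSpan` — the instance `S = ∅`: modulo 12305 and 13633 the crux
  is exactly its restriction to symbols outside the standard span `RelSpan` (the Yamamoto–Das
  classes: level 12 = `DasGapTwelve`, 15, 20, 21, …, and the deep classes 33, 35, 39, 44, …).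

So for EVERY set of instances settled by other means the crux is equivalent, modulo cruxes 12305
and 13633, to its residual beyond the span of their symbols — the planners may peel solved gap
classes off the residual item without a new glue item each time. No new definitions: the solved
set and the residual enter as explicit hypotheses. References: Kontsevich–Zagier 2001 §1.2, §4.1;
Deligne LNM 900 §7 (Koblitz–Ogus appendix); Das 2000.
-/

noncomputable section

open MeasureTheory Set
open scoped BigOperators

namespace Summit.KontsevichZagierPeriods.GammaHodgeSectorKO

open Literature.NumberTheory.Transcendental
open Literature.NumberTheory.Transcendental.KZ
open Literature.NumberTheory.Transcendental.BetaSymbol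
open Summit.KontsevichZagierPeriods.GammaHodgeSectorNegative
  (Admissible HodgeCondition IsCubeBetaRep IsBallCubeRep gammaHodgeSector_iff
   value_of_isCubeBetaRep value_of_isBallCubeRep)
open Summit.KontsevichZagierPeriods.KontsevichZagierPeriods.Theses.TerasomaMultiplication
  (GammaHodgeSector MultiplicationAccessible BetaCancellation)
open Summit.KontsevichZagierPeriods.TerasomaMultiplication.GammaHodgeFromRelators
  (realisation_of isConstMultiple_of_mem_relatorPairs betaClass_symm isConstMultiple_betaClass_transl
   betaClass_one_one betaClass_reassoc isConstMultiple_betaClass_refl)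

/-! ## §1 Instances are solved pairs -/

/-- **Every instance of the crux is a solved pair.** If ONE pinned pair `(r, r')` of the datum
`(k; x, y; x', y'; c)` (positive exponents, `c` algebraic) is equivalent, then the Beta words
satisfy `Π_j β(x_j,y_j) = κ(c) · (β(½,½)^k · Π_l β(x'_l,y'_l))` in `P`, with `0 < c` — the
product bookkeeping of the landed `stub_products`, value equality by soundness. [folklore] -/
theorem isConstMultiple_of_instance {N N' k : ℕ} (x y : Fin N → ℚ) (x' y' : Fin N' → ℚ) (c : ℝ)
    (hx : ∀ j, 0 < x j ∧ 0 < y j) (hx' : ∀ l, 0 < x' l ∧ 0 < y' l) (hc : IsAlgebraic ℚ c)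
    (r : IntegralRep N) (r' : IntegralRep (2 * k + N'))
    (hr : IsCubeBetaRep x y r) (hr' : IsBallCubeRep k x' y' c r') (h : Equivalent r r') :
    0 < c ∧ prodClass (wordMultiset x y) =
      kap c hc * prodClass (wordMultiset x' y' + k • ({((1:ℚ) / 2, (1:ℚ) / 2)} : Multiset (ℚ × ℚ))) := by
  obtain ⟨hcube, hball, -⟩ := stub_products
  have h1 : toFormalPeriod (of r) = prodClass (wordMultiset x y) := by
    rw [prodClass_wordMultiset]; exact hcube x y r hx hr
  have h2 : toFormalPeriod (of r') =
      kap c hc * prodClass (wordMultiset x' y' + k • ({((1:ℚ) / 2, (1:ℚ) / 2)} : Multiset (ℚ × ℚ))) := by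
    rw [prodClass_add, prodClass_nsmul, prodClass_singleton, prodClass_wordMultiset, hball k x' y' c hc r' hx' hr']
    ring
  refine ⟨?_, by rw [← h1, ← h2]; exact h.toFormalPeriod_eq⟩
  -- `0 < c` from value equality (soundness) and positivity of the Beta values
  have hv : r.value = r'.value := Equivalent.value_eq_holds h
  rw [value_of_isCubeBetaRep hx hr, value_of_isBallCubeRep hx' hr'] at hv
  have hpos : 0 < ∏ j, ProbabilityTheory.beta (x j : ℝ) (y j) :=
    Finset.prod_pos fun j _ => ProbabilityTheory.beta_pos (by exact_mod_cast (hx j).1) (by exact_mod_cast (hx j).2)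
  have hpos' : 0 < Real.pi ^ k * ∏ l, ProbabilityTheory.beta (x' l : ℝ) (y' l) :=
    mul_pos (pow_pos Real.pi_pos k) (Finset.prod_pos fun l _ =>
      ProbabilityTheory.beta_pos (by exact_mod_cast (hx' l).1) (by exact_mod_cast (hx' l).2))
  have : 0 < c * (Real.pi ^ k * ∏ l, ProbabilityTheory.beta (x' l : ℝ) (y' l)) := by
    rw [← mul_assoc, ← hv]; exact hpos
  exact (mul_pos_iff_of_pos_right hpos').mp this

/-- **The crux solves every admissible Hodge-type pair**: under `GammaHodgeSector`, for admissible
Hodge-type data and an algebraic `c` for which equal-valued pinned representations exist (i.e. the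
Deligne identity holds, `exists_pinned_valueEq_iff`), the pair of Beta words holds in `P` up to the
positive constant `c`. [cite: Deligne1982HodgeCycles, Thm. 7.18] -/
theorem isConstMultiple_of_gammaHodgeSector (h : GammaHodgeSector) {N N' k : ℕ}
    (x y : Fin N → ℚ) (x' y' : Fin N' → ℚ) (c : ℝ) (hx : Admissible x y) (hx' : Admissible x' y')
    (hH : HodgeCondition N N' k x y x' y') (hc : IsAlgebraic ℚ c)
    (r : IntegralRep N) (r' : IntegralRep (2 * k + N'))
    (hr : IsCubeBetaRep x y r) (hr' : IsBallCubeRep k x' y' c r') (hv : r.value = r'.value) :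
    IsConstMultiple (prodClass (wordMultiset x y))
      (prodClass (wordMultiset x' y' + k • ({((1:ℚ) / 2, (1:ℚ) / 2)} : Multiset (ℚ × ℚ)))) := by
  have hpos : ∀ j, 0 < x j ∧ 0 < y j := fun j => ⟨(hx j).1, (hx j).2.1⟩
  have hpos' : ∀ l, 0 < x' l ∧ 0 < y' l := fun l => ⟨(hx' l).1, (hx' l).2.1⟩
  obtain ⟨hc0, hEq⟩ := isConstMultiple_of_instance x y x' y' c hpos hpos' hc r r' hr hr'
    (gammaHodgeSector_iff.mp h N N' k x y x' y' c hx hx' hH hc r r' hr hr' hv)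
  exact ⟨c, hc, hc0, hEq⟩

/-- **The crux contains every residual** (restriction: the extra membership hypothesis is idle).
[folklore] -/
theorem gap_of_gammaHodgeSector (h : GammaHodgeSector) (G : AddSubgroup BSym) :
    ∀ (N N' k : ℕ) (x y : Fin N → ℚ) (x' y' : Fin N' → ℚ) (c : ℝ),
      Admissible x y → Admissible x' y' → HodgeCondition N N' k x y x' y' → IsAlgebraic ℚ c →
      wordSym x y - wordSym x' y' - k • bsym (1 / 2) (1 / 2) ∉ G →
      ∀ (r : IntegralRep N) (r' : IntegralRep (2 * k + N')),
        IsCubeBetaRep x y r → IsBallCubeRep k x' y' c r' → r.value = r'.value → Equivalent r r' :=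
  fun N N' k x y x' y' c hx hx' hH hc _ r r' hr hr' hv =>
    gammaHodgeSector_iff.mp h N N' k x y x' y' c hx hx' hH hc r r' hr hr' hv

/-! ## §2 The parametric compiler -/

/-- `RelSpan ⊔ ⟨S⟩` lies in the span of the pairs `relatorPairs ∪ S`. [folklore] -/
theorem relSpan_sup_closure_le (S : Set (Multiset (ℚ × ℚ) × Multiset (ℚ × ℚ))) :
    RelSpan ⊔ AddSubgroup.closure ((fun p => msym p.1 - msym p.2) '' S) ≤
      AddSubgroup.closure ((fun p => msym p.1 - msym p.2) '' (relatorPairs ∪ S)) :=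
  sup_le (AddSubgroup.closure_mono (Set.image_mono subset_union_left))
    (AddSubgroup.closure_mono (Set.image_mono subset_union_right))

/-- **THE PARAMETRIC RELATOR COMPILER.** Let `S` be any set of pairs of Beta words each of which
holds in `P` up to a positive algebraic constant (solved instances, `isConstMultiple_of_instance`).
Under `MultiplicationAccessible` (Gauss multiplication as chains) and `BetaCancellation` (Beta
classes are non-zero-divisors) — Euler reflection at rational arguments being PROVED in the tree —
the crux follows from its restriction to the data whose symbol
`Σ_j [x_j,y_j] − Σ_l [x'_l,y'_l] − k·[½,½]` lies OUTSIDE `RelSpan ⊔ ⟨sym L − sym R : (L,R) ∈ S⟩`: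
inside, realisation over the fraction field of `P` (`realisation_of`) turns the symbol congruence
into `Π β(W) = κ(q)·Π β(W' ⊎ {(½,½)}^k)`, the product bookkeeping identifies both sides with
`⟦r⟧`, `κ(c)⁻¹… ⟦r'⟧`, and `r.value = r'.value` pins `q = c`. [cite: Deligne1982HodgeCycles, Thm. 7.18] -/
theorem gammaHodgeSector_of_solvedPairs (hM : MultiplicationAccessible) (hB : BetaCancellation)
    (S : Set (Multiset (ℚ × ℚ) × Multiset (ℚ × ℚ)))
    (hS : ∀ p ∈ S, IsConstMultiple (prodClass p.1) (prodClass p.2))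
    (hGap : ∀ (N N' k : ℕ) (x y : Fin N → ℚ) (x' y' : Fin N' → ℚ) (c : ℝ),
      Admissible x y → Admissible x' y' → HodgeCondition N N' k x y x' y' → IsAlgebraic ℚ c →
      wordSym x y - wordSym x' y' - k • bsym (1 / 2) (1 / 2) ∉
        RelSpan ⊔ AddSubgroup.closure ((fun p => msym p.1 - msym p.2) '' S) →
      ∀ (r : IntegralRep N) (r' : IntegralRep (2 * k + N')),
        IsCubeBetaRep x y r → IsBallCubeRep k x' y' c r' → r.value = r'.value → Equivalent r r') :
    GammaHodgeSector := by
  rw [gammaHodgeSector_iff]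
  intro N N' k x y x' y' c hx hx' hH hc r r' hr hr' hv
  by_cases hmem : wordSym x y - wordSym x' y' - k • bsym (1 / 2) (1 / 2) ∈
      RelSpan ⊔ AddSubgroup.closure ((fun p => msym p.1 - msym p.2) '' S)
  swap
  · exact hGap N N' k x y x' y' c hx hx' hH hc hmem r r' hr hr' hv
  obtain ⟨hcube, hball, hmult⟩ := stub_products
  have hEuler := Summit.KontsevichZagierPeriods.KontsevichZagierPeriods.BetaCancellationLine.stub_eulerReflection
  have hpos : ∀ j, 0 < x j ∧ 0 < y j := fun j => ⟨(hx j).1, (hx j).2.1⟩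
  have hpos' : ∀ l, 0 < x' l ∧ 0 < y' l := fun l => ⟨(hx' l).1, (hx' l).2.1⟩
  -- the two Beta words
  set m₁ : Multiset (ℚ × ℚ) := wordMultiset x y with hm₁
  set m₂ : Multiset (ℚ × ℚ) := wordMultiset x' y' + k • ({((1:ℚ) / 2, (1:ℚ) / 2)} : Multiset (ℚ × ℚ))
    with hm₂
  have hsym : msym m₁ - msym m₂ = wordSym x y - wordSym x' y' - k • bsym (1 / 2) (1 / 2) := by
    simp only [hm₁, hm₂, msym_add, msym_nsmul, msym_singleton, msym_wordMultiset]
    abel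
  have hP₂ : prodClass m₂ = betaClass (1 / 2) (1 / 2) ^ k * ∏ l, betaClass (x' l) (y' l) := by
    rw [hm₂, prodClass_add, prodClass_nsmul, prodClass_singleton, prodClass_wordMultiset, mul_comm]
  -- realisation over the compiler pairs `relatorPairs ∪ S`
  have hreal : IsConstMultiple (prodClass m₁) (prodClass m₂) := by
    refine realisation_of hB (relatorPairs ∪ S) ?_ m₁ m₂ ?_
    · rintro p (hp | hp)
      · exact isConstMultiple_of_mem_relatorPairs betaClass_symm isConstMultiple_betaClass_transl
          betaClass_one_one betaClass_reassoc (isConstMultiple_betaClass_refl hEuler) (hmult hM) p hp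
      · exact hS p hp
    · rw [hsym]
      exact relSpan_sup_closure_le S hmem
  obtain ⟨q, hq, hq0, hqeq⟩ := hreal
  -- the two representations in `P`
  have h1 : toFormalPeriod (of r) = kap q hq * prodClass m₂ := by
    rw [← hqeq, hm₁, prodClass_wordMultiset]
    exact hcube x y r hpos hr
  have h2 : toFormalPeriod (of r') = kap c hc * prodClass m₂ := by
    rw [hP₂, ← mul_assoc]
    exact hball k x' y' c hc r' hpos' hr'
  -- evaluation pins the constant
  have hE : 0 < evalP (prodClass m₂) := by
    rw [hP₂, map_mul]
    exact mul_pos (evalP_betaHalf_pow_pos k) (evalP_prod_betaClass_pos x' y' hpos')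
  have e1 := congrArg evalP h1
  have e2 := congrArg evalP h2
  rw [evalP_toFormalPeriod_of, map_mul, evalP_kap] at e1 e2
  rw [hv] at e1
  have hqc : q = c := mul_right_cancel₀ hE.ne' (e1.symm.trans e2)
  have h3 : toFormalPeriod (of r) = toFormalPeriod (of r') := by
    rw [h1, h2, kap_congr hq hc hqc]
  exact toFormalPeriod_eq_iff.mp h3

/-- **The instance `S = ∅`.** Modulo `MultiplicationAccessible` and `BetaCancellation` the crux is
exactly its restriction to the data whose symbol lies outside the standard span `RelSpan` (the
Yamamoto–Das gap classes; level 12 = `DasGapTwelve`). [cite: Das2000] -/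
theorem gammaHodgeSector_of_gapBeyondRelSpan (hM : MultiplicationAccessible) (hB : BetaCancellation)
    (hGap : ∀ (N N' k : ℕ) (x y : Fin N → ℚ) (x' y' : Fin N' → ℚ) (c : ℝ),
      Admissible x y → Admissible x' y' → HodgeCondition N N' k x y x' y' → IsAlgebraic ℚ c →
      wordSym x y - wordSym x' y' - k • bsym (1 / 2) (1 / 2) ∉ RelSpan →
      ∀ (r : IntegralRep N) (r' : IntegralRep (2 * k + N')),
        IsCubeBetaRep x y r → IsBallCubeRep k x' y' c r' → r.value = r'.value → Equivalent r r') :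
    GammaHodgeSector := by
  refine gammaHodgeSector_of_solvedPairs hM hB ∅ (fun p hp => absurd hp (Set.notMem_empty p)) ?_
  intro N N' k x y x' y' c hx hx' hH hc hmem
  refine hGap N N' k x y x' y' c hx hx' hH hc fun h => hmem ?_
  exact AddSubgroup.mem_sup_left h

/-- **Instances in, residual out.** The compiler fed with a set of INSTANCES of the crux proved
by any means: if for every pair in `S` some datum of the crux with equivalent pinned
representations has exactly these Beta words, then under `MultiplicationAccessible` and
`BetaCancellation` the crux reduces to its residual beyond `RelSpan ⊔ ⟨S⟩`. [folklore] -/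
theorem gammaHodgeSector_of_instances (hM : MultiplicationAccessible) (hB : BetaCancellation)
    (S : Set (Multiset (ℚ × ℚ) × Multiset (ℚ × ℚ)))
    (hS : ∀ p ∈ S, ∃ (N N' k : ℕ) (x y : Fin N → ℚ) (x' y' : Fin N' → ℚ) (c : ℝ)
      (_ : IsAlgebraic ℚ c) (r : IntegralRep N) (r' : IntegralRep (2 * k + N')),
      (∀ j, 0 < x j ∧ 0 < y j) ∧ (∀ l, 0 < x' l ∧ 0 < y' l) ∧
      IsCubeBetaRep x y r ∧ IsBallCubeRep k x' y' c r' ∧ Equivalent r r' ∧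
      p = (wordMultiset x y, wordMultiset x' y' + k • ({((1:ℚ) / 2, (1:ℚ) / 2)} : Multiset (ℚ × ℚ))))
    (hGap : ∀ (N N' k : ℕ) (x y : Fin N → ℚ) (x' y' : Fin N' → ℚ) (c : ℝ),
      Admissible x y → Admissible x' y' → HodgeCondition N N' k x y x' y' → IsAlgebraic ℚ c →
      wordSym x y - wordSym x' y' - k • bsym (1 / 2) (1 / 2) ∉
        RelSpan ⊔ AddSubgroup.closure ((fun p => msym p.1 - msym p.2) '' S) →
      ∀ (r : IntegralRep N) (r' : IntegralRep (2 * k + N')),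
        IsCubeBetaRep x y r → IsBallCubeRep k x' y' c r' → r.value = r'.value → Equivalent r r') :
    GammaHodgeSector := by
  refine gammaHodgeSector_of_solvedPairs hM hB S (fun p hp => ?_) hGap
  obtain ⟨N, N', k, x, y, x', y', c, hc, r, r', hx, hx', hr, hr', hEq, rfl⟩ := hS p hp
  obtain ⟨hc0, h⟩ := isConstMultiple_of_instance x y x' y' c hx hx' hc r r' hr hr' hEq
  exact ⟨c, hc, hc0, h⟩

end Summit.KontsevichZagierPeriods.GammaHodgeSectorKO

/-! ## Appendix (lead seat c2): the compiler fed by the other routes' sectors — the typed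
SURFACE / DEEP split of the crux. `GammaHodgePairs` (crux stmt-3743, route `MotivatedMoves`: the
divisor range `N + N' = 2` — divisor classes on `F_d × F_d`, isogeny-induced, known mathematics) and
`BetaLinearSector` (crux stmt-3897, route `FermatIsogeny`) supply solved pairs, so the crux follows
from either of them, 12305, 13633 and the residual beyond the span of their symbols — for the pairs
this residual is the DEEP sector (same-level gap census, D ≤ 46: pairs generate `H_D/S_D` at
12, 15, 20, 21, 24, 28, 30, 36, 39, 40, 42, 45 and not at 33, 35, 44, classes on Fermat varieties of
dimension ≥ 4; HARDNESS-Fermat33.md). First proposed as `…GammaHodgeSectorBridges.lean`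
(p106999/p109144, bounced by gate restarts while the farm had not built this module). -/

namespace Summit.KontsevichZagierPeriods.GammaHodgeSectorKO

open Literature.NumberTheory.Transcendental
open Literature.NumberTheory.Transcendental.KZ
open Literature.NumberTheory.Transcendental.BetaSymbol
open Summit.KontsevichZagierPeriods.GammaHodgeSectorNegative
  (Admissible HodgeCondition IsCubeBetaRep IsBallCubeRep gammaHodgeSector_iff DeligneIdentity
   cubeRep ballCubeRep isCubeBetaRep_cubeRep isBallCubeRep_ballCubeRep valueEq_iff_deligneIdentity)
open Summit.KontsevichZagierPeriods.KontsevichZagierPeriods.Theses.TerasomaMultiplication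
  (GammaHodgeSector MultiplicationAccessible BetaCancellation)
open Summit.KontsevichZagierPeriods.KontsevichZagierPeriods.Theses.MotivatedMoves (GammaHodgePairs)
open Summit.KontsevichZagierPeriods.KontsevichZagierPeriods.Theses.FermatIsogeny (BetaLinearSector)
open Summit.KontsevichZagierPeriods.KontsevichZagierPeriods.BetaCancellationNegative (betaKernel)

/-- `GammaHodgePairs` unfolded into the pinning vocabulary (definitional). [folklore] -/
theorem gammaHodgePairs_iff :
    GammaHodgePairs ↔
      ∀ (N N' k : ℕ), N + N' = 2 → ∀ (x y : Fin N → ℚ) (x' y' : Fin N' → ℚ) (c : ℝ),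
        Admissible x y → Admissible x' y' → HodgeCondition N N' k x y x' y' → IsAlgebraic ℚ c →
        ∀ (r : IntegralRep N) (r' : IntegralRep (2 * k + N')),
          IsCubeBetaRep x y r → IsBallCubeRep k x' y' c r' → r.value = r'.value → Equivalent r r' :=
  ⟨fun h N N' k hNN x y x' y' c hx hx' hH hc r r' hr hr' hv =>
      h N N' k hNN x y x' y' c hx hx' hH hc r r' hr.1 hr.2 hr'.1 hr'.2 hv,
    fun h N N' k hNN x y x' y' c hx hx' hH hc r r' hd hi hd' hi' hv =>
      h N N' k hNN x y x' y' c hx hx' hH hc r r' ⟨hd, hi⟩ ⟨hd', hi'⟩ hv⟩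

/-- **The crux contains its divisor range** (restriction). [folklore] -/
theorem gammaHodgePairs_of_gammaHodgeSector (h : GammaHodgeSector) : GammaHodgePairs :=
  gammaHodgePairs_iff.mpr fun N N' k _ x y x' y' c hx hx' hH hc r r' hr hr' hv =>
    gammaHodgeSector_iff.mp h N N' k x y x' y' c hx hx' hH hc r r' hr hr' hv

/-- **Every instance of the divisor range is a solved pair**: under `GammaHodgePairs`, for admissible
Hodge-type data with `N + N' = 2` and an algebraic `c` satisfying the Deligne identity
`Π B(x,y) = c·π^k·Π B(x',y')`, the Beta words hold in `P` up to the positive constant `c` (apply the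
hypothesis to the canonical representations `cubeRep`, `ballCubeRep`, then
`isConstMultiple_of_instance`). [cite: Deligne1982HodgeCycles, Thm. 7.18] -/
theorem isConstMultiple_of_gammaHodgePairs (hP : GammaHodgePairs) {N N' k : ℕ} (hNN : N + N' = 2)
    (x y : Fin N → ℚ) (x' y' : Fin N' → ℚ) (c : ℝ) (hx : Admissible x y) (hx' : Admissible x' y')
    (hH : HodgeCondition N N' k x y x' y') (hc : IsAlgebraic ℚ c) (hD : DeligneIdentity k x y x' y' c) :
    IsConstMultiple (prodClass (wordMultiset x y))
      (prodClass (wordMultiset x' y' + k • ({((1:ℚ) / 2, (1:ℚ) / 2)} : Multiset (ℚ × ℚ)))) := by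
  have hpos : ∀ j, 0 < x j ∧ 0 < y j := fun j => ⟨(hx j).1, (hx j).2.1⟩
  have hpos' : ∀ l, 0 < x' l ∧ 0 < y' l := fun l => ⟨(hx' l).1, (hx' l).2.1⟩
  have hEq : Equivalent (cubeRep x y hpos) (ballCubeRep k x' y' c hc hpos') :=
    gammaHodgePairs_iff.mp hP N N' k hNN x y x' y' c hx hx' hH hc _ _ (isCubeBetaRep_cubeRep x y hpos)
      (isBallCubeRep_ballCubeRep k x' y' c hc hpos')
      ((valueEq_iff_deligneIdentity hpos hpos' (isCubeBetaRep_cubeRep x y hpos)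
        (isBallCubeRep_ballCubeRep k x' y' c hc hpos')).mpr hD)
  obtain ⟨hc0, h⟩ := isConstMultiple_of_instance x y x' y' c hpos hpos' hc _ _
    (isCubeBetaRep_cubeRep x y hpos) (isBallCubeRep_ballCubeRep k x' y' c hc hpos') hEq
  exact ⟨c, hc, hc0, h⟩

/-- **THE CROSS-ROUTE BRIDGE: the crux from its divisor range, the route's cruxes 12305 and 13633,
and the DEEP RESIDUAL.** The deep residual is `GammaHodgeSector` verbatim restricted to the data
whose Beta symbol lies outside `RelSpan ⊔ ⟨symbols of the N + N' = 2 instances⟩`; everything inside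
is compiled from `GammaHodgePairs` (solved pairs, `isConstMultiple_of_gammaHodgePairs`), Gauss
multiplication (`MultiplicationAccessible`) and Beta cancellation (`BetaCancellation`) by the
parametric relator compiler. [cite: Deligne1982HodgeCycles, Thm. 7.18] -/
theorem gammaHodgeSector_of_gammaHodgePairs (hP : GammaHodgePairs) (hM : MultiplicationAccessible)
    (hB : BetaCancellation)
    (hDeep : ∀ (N N' k : ℕ) (x y : Fin N → ℚ) (x' y' : Fin N' → ℚ) (c : ℝ),
      Admissible x y → Admissible x' y' → HodgeCondition N N' k x y x' y' → IsAlgebraic ℚ c →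
      wordSym x y - wordSym x' y' - k • bsym (1 / 2) (1 / 2) ∉
        RelSpan ⊔ AddSubgroup.closure {v | ∃ (M M' e : ℕ) (a b : Fin M → ℚ) (a' b' : Fin M' → ℚ) (q : ℝ),
          M + M' = 2 ∧ Admissible a b ∧ Admissible a' b' ∧ HodgeCondition M M' e a b a' b' ∧
          IsAlgebraic ℚ q ∧ DeligneIdentity e a b a' b' q ∧
          v = wordSym a b - wordSym a' b' - e • bsym (1 / 2) (1 / 2)} →
      ∀ (r : IntegralRep N) (r' : IntegralRep (2 * k + N')),
        IsCubeBetaRep x y r → IsBallCubeRep k x' y' c r' → r.value = r'.value → Equivalent r r') :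
    GammaHodgeSector := by
  classical
  -- the solved set: the Beta-word pairs of the `N + N' = 2` instances
  let S : Set (Multiset (ℚ × ℚ) × Multiset (ℚ × ℚ)) :=
    {p | ∃ (M M' e : ℕ) (a b : Fin M → ℚ) (a' b' : Fin M' → ℚ) (q : ℝ),
      M + M' = 2 ∧ Admissible a b ∧ Admissible a' b' ∧ HodgeCondition M M' e a b a' b' ∧
      IsAlgebraic ℚ q ∧ DeligneIdentity e a b a' b' q ∧
      p = (wordMultiset a b, wordMultiset a' b' + e • ({((1:ℚ) / 2, (1:ℚ) / 2)} : Multiset (ℚ × ℚ)))}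
  refine gammaHodgeSector_of_solvedPairs hM hB S ?_ ?_
  · rintro p ⟨M, M', e, a, b, a', b', q, hMM, ha, ha', hH, hq, hD, rfl⟩
    exact isConstMultiple_of_gammaHodgePairs hP hMM a b a' b' q ha ha' hH hq hD
  · intro N N' k x y x' y' c hx hx' hH hc hmem
    refine hDeep N N' k x y x' y' c hx hx' hH hc fun h => hmem ?_
    -- the symbol span of the instances is the span of the symbols of `S`
    refine (sup_le_sup_left (AddSubgroup.closure_mono ?_) RelSpan) h
    rintro v ⟨M, M', e, a, b, a', b', q, hMM, ha, ha', hH', hq, hD, rfl⟩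
    refine ⟨(wordMultiset a b, wordMultiset a' b' + e • ({((1:ℚ) / 2, (1:ℚ) / 2)} : Multiset (ℚ × ℚ))),
      ⟨M, M', e, a, b, a', b', q, hMM, ha, ha', hH', hq, hD, rfl⟩, ?_⟩
    simp only [msym_add, msym_nsmul, msym_singleton, msym_wordMultiset]
    abel

/-! ## The Beta-linear sector of route `FermatIsogeny` feeds the same compiler -/

/-- **Every instance of `BetaLinearSector` is a solved pair**: if `B(a,b) = q·B(a',b')` (`q` real
algebraic, `0 < a, b, a', b'`), then `β(a,b) = κ(q)·β(a',b')` in `P`, `0 < q`. [cite: KoblitzRohrlich1978, p. 1184] -/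
theorem isConstMultiple_of_betaLinearSector (hL : BetaLinearSector) {a b a' b' : ℚ} {q : ℝ}
    (ha : 0 < a) (hb : 0 < b) (ha' : 0 < a') (hb' : 0 < b') (hq : IsAlgebraic ℚ q)
    (hD : ProbabilityTheory.beta a b = q * ProbabilityTheory.beta a' b') :
    IsConstMultiple (betaClass a b) (betaClass a' b') := by
  set r : IntegralRep 1 := betaRep a b ha hb with hr
  set r' : IntegralRep 1 := (betaRep a' b' ha' hb').constMul q hq with hr'
  have hv : r.value = r'.value := by
    rw [hr, hr', IntegralRep.value_constMul, betaRep_value, betaRep_value, hD]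
  have hEq : Equivalent r r' := by
    refine hL a b a' b' q ha hb ha' hb' hq r r' rfl ?_ rfl ?_ hv
    · intro x _
      rw [hr, betaRep_integrand]
      rfl
    · intro x _
      rw [hr', IntegralRep.integrand_constMul, betaRep_integrand]
      simp only [betaKernel]
      ring
  have hq0 : 0 < q := by
    have h1 : 0 < ProbabilityTheory.beta (a : ℝ) b :=
      ProbabilityTheory.beta_pos (by exact_mod_cast ha) (by exact_mod_cast hb)
    have h2 : 0 < ProbabilityTheory.beta (a' : ℝ) b' :=
      ProbabilityTheory.beta_pos (by exact_mod_cast ha') (by exact_mod_cast hb')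
    rw [hD] at h1
    exact (mul_pos_iff_of_pos_right h2).mp h1
  refine ⟨q, hq, hq0, ?_⟩
  rw [betaClass_eq _ _ ha hb, hEq.toFormalPeriod_eq, hr',
    Summit.KontsevichZagierPeriods.TerasomaMultiplication.GammaHodgeFromRelators.toFormalPeriod_of_constMul,
    ← betaClass_eq _ _ ha' hb']

/-- **The crux from the Beta-linear sector, cruxes 12305 and 13633, and the residual beyond linear
pairs** (`GammaHodgeSector` verbatim outside `RelSpan ⊔ ⟨[a,b] − [a',b'] : B(a,b) = q·B(a',b'), q alg.⟩`;
inside, `gammaHodgeSector_of_solvedPairs` fed with `isConstMultiple_of_betaLinearSector`). [cite: Deligne1982HodgeCycles, Thm. 7.18] -/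
theorem gammaHodgeSector_of_betaLinearSector (hL : BetaLinearSector) (hM : MultiplicationAccessible)
    (hB : BetaCancellation)
    (hRes : ∀ (N N' k : ℕ) (x y : Fin N → ℚ) (x' y' : Fin N' → ℚ) (c : ℝ),
      Admissible x y → Admissible x' y' → HodgeCondition N N' k x y x' y' → IsAlgebraic ℚ c →
      wordSym x y - wordSym x' y' - k • bsym (1 / 2) (1 / 2) ∉
        RelSpan ⊔ AddSubgroup.closure {v | ∃ (a b a' b' : ℚ) (q : ℝ),
          0 < a ∧ 0 < b ∧ 0 < a' ∧ 0 < b' ∧ IsAlgebraic ℚ q ∧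
          ProbabilityTheory.beta a b = q * ProbabilityTheory.beta a' b' ∧ v = bsym a b - bsym a' b'} →
      ∀ (r : IntegralRep N) (r' : IntegralRep (2 * k + N')),
        IsCubeBetaRep x y r → IsBallCubeRep k x' y' c r' → r.value = r'.value → Equivalent r r') :
    GammaHodgeSector := by
  classical
  let S : Set (Multiset (ℚ × ℚ) × Multiset (ℚ × ℚ)) :=
    {p | ∃ (a b a' b' : ℚ) (q : ℝ), 0 < a ∧ 0 < b ∧ 0 < a' ∧ 0 < b' ∧ IsAlgebraic ℚ q ∧
      ProbabilityTheory.beta a b = q * ProbabilityTheory.beta a' b' ∧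
      p = (({(a, b)} : Multiset (ℚ × ℚ)), ({(a', b')} : Multiset (ℚ × ℚ)))}
  refine gammaHodgeSector_of_solvedPairs hM hB S ?_ ?_
  · rintro p ⟨a, b, a', b', q, ha, hb, ha', hb', hq, hD, rfl⟩
    simp only [prodClass_singleton]
    exact isConstMultiple_of_betaLinearSector hL ha hb ha' hb' hq hD
  · intro N N' k x y x' y' c hx hx' hH hc hmem
    refine hRes N N' k x y x' y' c hx hx' hH hc fun h => hmem ?_
    refine (sup_le_sup_left (AddSubgroup.closure_mono ?_) RelSpan) h
    rintro v ⟨a, b, a', b', q, ha, hb, ha', hb', hq, hD, rfl⟩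
    exact ⟨(({(a, b)} : Multiset (ℚ × ℚ)), ({(a', b')} : Multiset (ℚ × ℚ))),
      ⟨a, b, a', b', q, ha, hb, ha', hb', hq, hD, rfl⟩, by simp [msym_singleton, bsym]⟩

end Summit.KontsevichZagierPeriods.GammaHodgeSectorKO

end
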